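import Mathlib
import Summits.MatrixMultiplication.MatrixMultiplication.Theses.ShapeSubmodularity
import Summits.MatrixMultiplication.MatrixMultiplication.Theorems.ShapeSubmodularityShapeSubmodularStubUnitExchangeBoundary
import Summits.MatrixMultiplication.MatrixMultiplication.Theorems.ShapeSubmodularityShapeSubmodularStubLocalToGlobal
import Summits.MatrixMultiplication.MatrixMultiplication.Theorems.ShapeSubmodularityShapeSubmodularStubExponentThreshold
import Summits.MatrixMultiplication.MatrixMultiplication.Theorems.ShapeSubmodularityShapeSubmodularStubFlatValue
import Summits.MatrixMultiplication.MatrixMultiplication.Theorems.ShapeSubmodularityShapeSubmodularStubCellOfFlatMeet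
import Summits.MatrixMultiplication.MatrixMultiplication.Theorems.ShapeSubmodularityShapeSubmodularStubCellOfSandwich
import Summits.MatrixMultiplication.MatrixMultiplication.Theorems.ShapeSubmodularityShapeSubmodularStubSandwichMono
import Summits.MatrixMultiplication.MatrixMultiplication.Theorems.ShapeSubmodularityShapeSubmodularStubSandwichRay11
import Summits.MatrixMultiplication.MatrixMultiplication.Theorems.ShapeSubmodularityShapeSubmodularStubSandwichRay22
import Summits.MatrixMultiplication.MatrixMultiplication.Theorems.ShapeSubmodularityShapeSubmodularStubDecompositionBound
import Summits.MatrixMultiplication.MatrixMultiplication.Theorems.ShapeSubmodularityShapeSubmodularStubCellOfRelSandwich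
import Literature.Computability.AlgebraicComplexity.RectangularExponentAlpha
import Literature.Computability.AlgebraicComplexity.KroneckerRank
import Literature.Computability.AlgebraicComplexity.RectangularExponent

/-!
# Crux `ShapeSubmodular` (stmt-MatrixMultiplication-15622) — `Lines/birth.lean` (line `registered`), RESHAPE 8

Route `ShapeSubmodularity`, crux #2 `ShapeSubmodular` (SUBMOD in rank form: the rectangular exponent
`(a,b,c) ↦ ω(a,b,c)` is submodular on the integer format lattice `ℕ³`).  Decomposition along the
DECREASING-DIFFERENCES line (Topkis): on a product of chains, lattice submodularity is equivalent to the
unit-square exchange law in each PAIR of coordinates, and the full `S₃`-symmetry of `R⟨k,m,n⟩`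
(Bläser 2013, Lemma 5.5 — in tree: `tensorRank_matMulTensor_rotate` / `_transpose`) collapses the three
pairs to one.

* RESHAPE 1 (gen-0 lead): the birth stub `stub_unitExchange` was split by the case `a = 0 ∨ b = 0 ∨ c = 0`
  into `stub_unitExchangeBoundary` and `stub_unitExchangeInterior`, glued by the sorry-free `unitExchange`.
* RESHAPE 2 (gen-1 lead, cycle c1): three of the four registered stubs LANDED as
  `--supports stmt-MatrixMultiplication-15622` Theorems files and are IMPORTED, not restated:
  `Theorems.ShapeSubmodular.stub_unitExchangeBoundary` (p146556), `…stub_localToGlobal` (p146420, Topkis),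
  `…stub_exponentThreshold` (p146467, `m = inf`); the one remaining stub `stub_unitExchangeInterior` was shown
  kernel-equivalent to the crux (`unitExchangeInterior_of_ShapeSubmodular`).
* RESHAPE 3 (gen-1 lead, cycle c2, this file): the interior stub is NARROWED.  Write `α = dualExponentAlpha ℂ`
  (`RectangularExponent.lean`; `ω(1,p,1) = 2 ↔ p ≤ α`, proved in `RectangularExponentAlpha.lean`) and call a
  natural format `(a,b,c)` α-FLAT when `min(a,b,c) ≤ α · median(a,b,c)`.  A flat format has the flattening
  value `ω(a,b,c) = max(a+b, b+c, a+c)` (homogeneity + `ω(1,p,1) = 2` + one-sided blocking) — stub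
  `stub_flatValue` (PROVABLE, wave 2) — and the unit cell whose MEET `(a,b,c)` is flat satisfies the exchange
  law (one-decade blocking on the join + the flattening lower bound on the opposite hypothesis format) — stub
  `stub_cellOfFlatMeet` (PROVABLE, wave 2).  What is left is `stub_coreExchange` (OPEN, load-bearing, lead):
  the exchange law on the FAT CORE `α · median(a,b,c) < min(a,b,c)`, a cone around the diagonal containing
  every cube cell `(k,k,k)`.  The glue `flatValue_of_alpha` (sorting the format by the `S₃`-symmetry of the
  rank) and `unitExchangeInterior` (case split flat / core) are real proofs.  The landed boundary stub is the
  case `α ≥ 0` of the flat family, and `α = 1` (`↔ ω = 2`, `dualExponentAlpha_eq_one_iff`) makes EVERY meet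
  flat, so `ShapeSubmodular_of` specialises to the route's `SubmodOfOmegaTwo`.
  `coreExchange_of_ShapeSubmodular` records the converse: crux ⟺ open stub, still by construction.
* RESHAPE 4 (same cycle, after wave 2): `stub_flatValue` LANDED as p148738
  (`…StubFlatValue.lean`) and `stub_cellOfFlatMeet` as p149533 (`…StubCellOfFlatMeet.lean`); both are now
  IMPORTED (`Theorems.ShapeSubmodular.stub_flatValue`, `Theorems.ShapeSubmodular.stub_cellOfFlatMeet`), so the ONLY
  `sorry` of RESHAPE 4 is `stub_coreExchange` (the c2 lead then landed the reduction file p150686,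
  `Theorems.ShapeSubmodular.ShapeSubmodular_iff_coreExchange`).
* RESHAPE 5 (gen-1 lead, cycle c3, this file): the core stub is NARROWED a second time, by a mechanism
  independent of α — the MODULAR SANDWICH.  The flattening exponent `L = sum − min` is modular up to a defect
  `L(p) + L(q) − L(p ∨ q) − L(p ∧ q) ∈ {0, 1}`; on a unit cell with meet `(a,b,c)`, hypothesis formats
  `p = (a+1,b,c)`, `q = (a,b+1,c)` and join `(a+1,b+1,c)` the defect is `1` exactly when `a = b < c`.  Whenever
  join and meet admit upper exponents `u`, `u'` with `u + u' ≤ L(p) + L(q)` (the cell is SANDWICHABLE), the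
  exchange law holds outright — `γ = u`, `γ' = u'`, and `β ≥ L(p)`, `β' ≥ L(q)` by flattening — stub
  `stub_cellOfSandwich` (PROVABLE, wave 3).  With the vendored records this closes whole rays of the fat core:
  `(1,1,c)` for every `c ≥ 2` (ADVXXZ2025 Table 1: `2·2.371339 + 3.250035 = 7.992713 ≤ 8`, margin `0.0073`,
  out of reach of every pre-2021 square bound) and `(2,2,c)` for `c ≥ 9` (VXXZ2024 row `k = 3`:
  `2·0.198809 + 3·0.198809 ≤ 1`) — side stubs `stub_sandwichRay11`, `stub_sandwichRay22` (PROVABLE modulo the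
  named table facts, wave 3; deliberately NOT used by `ShapeSubmodular_of`, whose cone stays fact-free) and
  `stub_sandwichMono` (the sandwichable cells form an up-set in `c`, PROVABLE, wave 3).  What is left is
  `stub_coreExchange` restricted to the NON-SANDWICHABLE core (OPEN, load-bearing, lead): it contains every
  defect-0 cell of the core — all cube cells `(k,k,k)`, all cells with `a ≠ b`, all `(a,a,c)` with `c < a` — and
  the defect-1 cells `(a,a,c)`, `c > a`, whose excess `(a+1)·e(c/(a+1)) + a·e(c/a)` (`e(k) = ω(1,1,k) − k − 1`)
  is not yet certified `≤ 1`.  The glue `unitExchangeInterior` now case-splits core / sandwichable / rest.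
* RESHAPE 6 (same cycle, after wave 3): all four sandwich stubs LANDED — p153815 `stub_cellOfSandwich`
  (`…StubCellOfSandwich.lean`), p153826 `stub_sandwichMono`, p154066 `stub_sandwichRay11` (conditional on
  `advxxz2025_omegaRect_table`), p154024 `stub_sandwichRay22` (conditional on `vxxz2024_omegaRect_table`) — and are
  IMPORTED; the ONLY `sorry` of RESHAPE 6 is `stub_coreExchange` (non-sandwichable fat core).
* RESHAPE 7 (same cycle, after the c3 DERIVABILITY CENSUS `census-c3.md`): an exact LP per unit cell decides
  whether the exchange law follows from EVERYTHING the tree knows about `ω(·,·,·)` (symmetry, sublinearity,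
  monotonicity, 1-Lipschitz, flattening, the vendored tables); its dual solutions are RELATIVE-SANDWICH
  CERTIFICATES — `k·M` and `k·J` dominated by `P`, `σP`, `Q`, `σQ` (total weights `≤ k`) plus free formats paid from
  the flattening budget — and its primal solutions are explicit violating models.  Census (`a ≤ b ≤ 12`, `c ≤ 12`,
  936 cells): derivable = 198 flat + 15 sandwich + 18 flat-neighbour (`(a,3a,c ≥ 3a+1)`, fractional certificates);
  705 core cells, among them every cube `(k,k,k)` (room `k/(3k+1)`), are INDEPENDENT of all of it.  Hence the
  final split: `stub_cellOfRelSandwich` (certificate ⟹ cell, PROVABLE, wave 4, with the library stub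
  `stub_decompositionBound`) and `stub_coreExchange` = the certificate-free fat core (OPEN): every remaining cell
  needs a property of matrix multiplication that is not yet a theorem or a table.
* RESHAPE 8 (same cycle, after wave 4): both provable stubs LANDED — p155759 `stub_decompositionBound`
  (`…StubDecompositionBound.lean`), p156081 `stub_cellOfRelSandwich` (`…StubCellOfRelSandwich.lean`, built on the
  former) — and are IMPORTED; the ONLY `sorry` of this file is `stub_coreExchange` (certificate-free fat core).

`submod_of_parts` is the composition with the three birth statements as HYPOTHESES (real proof);
`ShapeSubmodular_of : ShapeSubmodular` applies it and concludes the crux BY NAME.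
No `sorry` outside `stub_coreExchange`; `ShapeSubmodular_of` depends on the nine landed stub theorems and on it; the
landed side theorems `stub_cellOfSandwich/sandwichMono/Ray11/Ray22` are corollary material (`relSandwich_of_sandwich`,
`cell_one_one_of_table`); the cone of `ShapeSubmodular_of` stays fact-free.
Disproof used: none exists for this crux (`ledger crux ls stmt-MatrixMultiplication-15622`, 2026-08-17T09:50Z:
PICKED.md, Lines/birth.{lean,md} only); no `Theorems/…/ShapeSubmodular/Negative/*`.
-/

set_option linter.dupNamespace false

namespace Summit.MatrixMultiplication.MatrixMultiplication.Cruxes.ShapeSubmodular.Birth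

open Summit.MatrixMultiplication.MatrixMultiplication.Theses.ShapeSubmodularity
open Literature.Computability.AlgebraicComplexity
open Filter Asymptotics

/-! ## The registered stub (RESHAPE 8: `stub_decompositionBound` p155759 and `stub_cellOfRelSandwich` p156081 LANDED in
wave 4 and are imported; `stub_coreExchange` — the certificate-free fat core — is the ONLY `sorry` of this file) -/

/-- THE ONE OPEN STUB (load-bearing — lead) — CORE EXCHANGE WITHOUT CERTIFICATE: the unit-square exchange law
in the coordinate pair (1,2) at fixed third coordinate, rank form, on the cells of the FAT CORE (meet `(a,b,c)`,
`a, b, c ≥ 1`, `α · median(a,b,c) < min(a,b,c)`, `median(a,b,c) = max (min a b) (min (max a b) c)`,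
`α = dualExponentAlpha ℂ`) that admit NO relative-sandwich certificate (hypothesis of `stub_cellOfRelSandwich`
negated).  In words: `ω(a+1,b+1,c) + ω(a,b,c) ≤ ω(a+1,b,c) + ω(a,b+1,c)` for the near-cubic formats where no
monotone-sublinear bookkeeping over the four formats of the cell and the known admissible bounds can pay for the
exchange; it contains every cube cell `(k,k,k)` (violation room `k/(3k+1)` in the census models) and at `(1,1,1)`
reads `ω(2,2,1) + ω ≤ 2·ω(1,1,2)` (room `1/4`).  By `coreExchange_of_ShapeSubmodular` (below, sorry-free) and
`ShapeSubmodular_of` the crux is kernel-equivalent to this statement; if `α = 1` (`↔ ω = 2`) its core hypothesis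
is never met. -/
theorem stub_coreExchange :
    ∀ a b c : ℕ, 1 ≤ a → 1 ≤ b → 1 ≤ c →
      Literature.Computability.AlgebraicComplexity.dualExponentAlpha ℂ *
          ((max (min a b) (min (max a b) c) : ℕ) : ℝ) < ((min a (min b c) : ℕ) : ℝ) →
      ¬ (∀ δ : ℝ, 0 < δ → ∃ k p₁ p₂ p₃ p₄ p₅ p₆ p₇ p₈ : ℕ, ∃ f₁ g₁ h₁ f₂ g₂ h₂ : ℕ, ∃ u₁ u₂ : ℝ,
        1 ≤ k ∧ p₁ + p₂ + p₅ + p₆ ≤ k ∧ p₃ + p₄ + p₇ + p₈ ≤ k ∧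
        k * a ≤ (p₁ + p₂) * (a + 1) + (p₃ + p₄) * a + f₁ ∧
        k * b ≤ p₁ * b + p₂ * c + p₃ * (b + 1) + p₄ * c + g₁ ∧
        k * c ≤ p₁ * c + p₂ * b + p₃ * c + p₄ * (b + 1) + h₁ ∧
        k * (a + 1) ≤ (p₅ + p₆) * (a + 1) + (p₇ + p₈) * a + f₂ ∧
        k * (b + 1) ≤ p₅ * b + p₆ * c + p₇ * (b + 1) + p₈ * c + g₂ ∧
        k * c ≤ p₅ * c + p₆ * b + p₇ * c + p₈ * (b + 1) + h₂ ∧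
        (fun n : ℕ => (Literature.Computability.AlgebraicComplexity.tensorRank
          (Literature.Computability.AlgebraicComplexity.matMulTensor ℂ (n ^ f₁) (n ^ g₁) (n ^ h₁)) : ℝ))
            =O[Filter.atTop] (fun n : ℕ => (n : ℝ) ^ u₁) ∧
        (fun n : ℕ => (Literature.Computability.AlgebraicComplexity.tensorRank
          (Literature.Computability.AlgebraicComplexity.matMulTensor ℂ (n ^ f₂) (n ^ g₂) (n ^ h₂)) : ℝ))
            =O[Filter.atTop] (fun n : ℕ => (n : ℝ) ^ u₂) ∧
        u₁ + u₂ + (((p₁ + p₂ + p₅ + p₆) * (max (a + 1 + b) (max (b + c) (a + 1 + c))) + (p₃ + p₄ + p₇ + p₈) * (max (a + (b + 1)) (max (b + 1 + c) (a + c))) : ℕ) : ℝ)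
          ≤ ((k * (max (a + 1 + b) (max (b + c) (a + 1 + c)) + max (a + (b + 1)) (max (b + 1 + c) (a + c))) : ℕ) : ℝ) + δ) →
      ∀ β β' : ℝ,
      (fun n : ℕ => (Literature.Computability.AlgebraicComplexity.tensorRank
        (Literature.Computability.AlgebraicComplexity.matMulTensor ℂ (n ^ (a + 1)) (n ^ b) (n ^ c)) : ℝ))
          =O[Filter.atTop] (fun n : ℕ => (n : ℝ) ^ β) →
      (fun n : ℕ => (Literature.Computability.AlgebraicComplexity.tensorRank
        (Literature.Computability.AlgebraicComplexity.matMulTensor ℂ (n ^ a) (n ^ (b + 1)) (n ^ c)) : ℝ))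
          =O[Filter.atTop] (fun n : ℕ => (n : ℝ) ^ β') →
      ∀ ε : ℝ, 0 < ε → ∃ γ γ' : ℝ, γ + γ' ≤ β + β' + ε ∧
        (fun n : ℕ => (Literature.Computability.AlgebraicComplexity.tensorRank
          (Literature.Computability.AlgebraicComplexity.matMulTensor ℂ
            (n ^ (a + 1)) (n ^ (b + 1)) (n ^ c)) : ℝ))
            =O[Filter.atTop] (fun n : ℕ => (n : ℝ) ^ γ) ∧
        (fun n : ℕ => (Literature.Computability.AlgebraicComplexity.tensorRank
          (Literature.Computability.AlgebraicComplexity.matMulTensor ℂ (n ^ a) (n ^ b) (n ^ c)) : ℝ))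
            =O[Filter.atTop] (fun n : ℕ => (n : ℝ) ^ γ') := by
  sorry

/-! ## Glue (real proofs): sorting a format, flat value at any flat format, the interior law -/

/-- SORTING A NATURAL FORMAT: `R⟨n^a, n^b, n^c⟩ = R⟨n^x, n^z, n^y⟩` with `x ≥ y ≥ z` the sorted
exponents (`x = max`, `y = median`, `z = min`, `x + y = max(a+b, b+c, a+c)`), by the `S₃`-symmetry of the
rank of matrix multiplication (Bläser 2013, Lemma 5.5: `tensorRank_matMulTensor_rotate`,
`tensorRank_matMulTensor_transpose`). -/
theorem rank_sort (a b c : ℕ) :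
    ∃ x y z : ℕ, z ≤ y ∧ y ≤ x ∧ x = max a (max b c) ∧ z = min a (min b c) ∧
      y = max (min a b) (min (max a b) c) ∧ x + y = max (a + b) (max (b + c) (a + c)) ∧
      ∀ n : ℕ, tensorRank (matMulTensor ℂ (n ^ a) (n ^ b) (n ^ c)) =
        tensorRank (matMulTensor ℂ (n ^ x) (n ^ z) (n ^ y)) := by
  rcases le_total b a with hba | hab
  · rcases le_total c b with hcb | hbc
    · -- `c ≤ b ≤ a`: `(x,y,z) = (a,b,c)`, target `⟨a,c,b⟩`
      refine ⟨a, b, c, hcb, hba, ?_, ?_, ?_, ?_, fun n => ?_⟩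
      · omega
      · omega
      · omega
      · omega
      · rw [tensorRank_matMulTensor_rotate ℂ (n ^ a) (n ^ b) (n ^ c),
          tensorRank_matMulTensor_transpose ℂ (n ^ b) (n ^ c) (n ^ a)]
    · rcases le_total c a with hca | hac
      · -- `b ≤ c ≤ a`: `(x,y,z) = (a,c,b)`, target `⟨a,b,c⟩`
        refine ⟨a, c, b, hbc, hca, ?_, ?_, ?_, ?_, fun n => rfl⟩
        · omega
        · omega
        · omega
        · omega
      · -- `b ≤ a ≤ c`: `(x,y,z) = (c,a,b)`, target `⟨c,b,a⟩`
        refine ⟨c, a, b, hba, hac, ?_, ?_, ?_, ?_, fun n => ?_⟩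
        · omega
        · omega
        · omega
        · omega
        · rw [tensorRank_matMulTensor_transpose ℂ (n ^ a) (n ^ b) (n ^ c)]
  · rcases le_total c a with hca | hac
    · -- `c ≤ a ≤ b`: `(x,y,z) = (b,a,c)`, target `⟨b,c,a⟩`
      refine ⟨b, a, c, hca, hab, ?_, ?_, ?_, ?_, fun n => ?_⟩
      · omega
      · omega
      · omega
      · omega
      · rw [tensorRank_matMulTensor_rotate ℂ (n ^ a) (n ^ b) (n ^ c)]
    · rcases le_total c b with hcb | hbc
      · -- `a ≤ c ≤ b`: `(x,y,z) = (b,c,a)`, target `⟨b,a,c⟩`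
        refine ⟨b, c, a, hac, hcb, ?_, ?_, ?_, ?_, fun n => ?_⟩
        · omega
        · omega
        · omega
        · omega
        · rw [tensorRank_matMulTensor_transpose ℂ (n ^ a) (n ^ b) (n ^ c),
            tensorRank_matMulTensor_rotate ℂ (n ^ c) (n ^ b) (n ^ a)]
      · -- `a ≤ b ≤ c`: `(x,y,z) = (c,b,a)`, target `⟨c,a,b⟩`
        refine ⟨c, b, a, hab, hbc, ?_, ?_, ?_, ?_, fun n => ?_⟩
        · omega
        · omega
        · omega
        · omega
        · rw [tensorRank_matMulTensor_rotate ℂ (n ^ a) (n ^ b) (n ^ c),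
            tensorRank_matMulTensor_rotate ℂ (n ^ b) (n ^ c) (n ^ a)]

/-- FLAT VALUE AT ANY α-FLAT FORMAT (glue, real proof): if `min(a,b,c) ≤ α · median(a,b,c)` with
`a, b, c ≥ 1`, then for every `ε > 0`, `R⟨n^a, n^b, n^c⟩ = O(n^{L+ε})`, `L = max(a+b, b+c, a+c)` — sort
the format (`rank_sort`) and apply the landed `Theorems.ShapeSubmodular.stub_flatValue` (p148738). -/
theorem flatValue_of_alpha (a b c : ℕ) (ha : 1 ≤ a) (hb : 1 ≤ b) (_hc : 1 ≤ c)
    (hflat : ((min a (min b c) : ℕ) : ℝ) ≤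
      dualExponentAlpha ℂ * ((max (min a b) (min (max a b) c) : ℕ) : ℝ)) :
    ∀ ε : ℝ, 0 < ε →
      (fun n : ℕ => (tensorRank (matMulTensor ℂ (n ^ a) (n ^ b) (n ^ c)) : ℝ)) =O[atTop]
        (fun n : ℕ => (n : ℝ) ^ (((max (a + b) (max (b + c) (a + c)) : ℕ) : ℝ) + ε)) := by
  intro ε hε
  obtain ⟨x, y, z, _hzy, hyx, hx, hz, hy, hxy, hR⟩ := rank_sort a b c
  have hy1 : 1 ≤ y := by
    rw [hy]
    exact le_max_of_le_left (le_min ha hb)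
  have hzα : (z : ℝ) ≤ dualExponentAlpha ℂ * (y : ℝ) := by
    rw [hz, hy]
    exact hflat
  have h := Theorems.ShapeSubmodular.stub_flatValue x y z hy1 hyx hzα ε hε
  have hfun : (fun n : ℕ => (tensorRank (matMulTensor ℂ (n ^ a) (n ^ b) (n ^ c)) : ℝ)) =
      fun n : ℕ => (tensorRank (matMulTensor ℂ (n ^ x) (n ^ z) (n ^ y)) : ℝ) := by
    funext n
    rw [hR n]
  have hexp : ((max (a + b) (max (b + c) (a + c)) : ℕ) : ℝ) = (x : ℝ) + (y : ℝ) := by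
    rw [← hxy]
    push_cast
    ring
  rw [hfun, hexp]
  exact h

/-- UNIT EXCHANGE IN THE INTERIOR (the RESHAPE-2 stub, a real proof modulo the registered stubs; after
RESHAPE 8 modulo `stub_coreExchange` only): case split on whether the meet `(a,b,c)` is α-flat (landed
`Theorems.ShapeSubmodular.stub_cellOfFlatMeet` p149533 ∘ `flatValue_of_alpha`), carries a relative-sandwich
certificate (landed `Theorems.ShapeSubmodular.stub_cellOfRelSandwich` p156081) or lies in the certificate-free
fat core (`stub_coreExchange`). -/
theorem unitExchangeInterior :
    ∀ a b c : ℕ, 1 ≤ a → 1 ≤ b → 1 ≤ c → ∀ β β' : ℝ,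
      (fun n : ℕ => (Literature.Computability.AlgebraicComplexity.tensorRank
        (Literature.Computability.AlgebraicComplexity.matMulTensor ℂ (n ^ (a + 1)) (n ^ b) (n ^ c)) : ℝ))
          =O[Filter.atTop] (fun n : ℕ => (n : ℝ) ^ β) →
      (fun n : ℕ => (Literature.Computability.AlgebraicComplexity.tensorRank
        (Literature.Computability.AlgebraicComplexity.matMulTensor ℂ (n ^ a) (n ^ (b + 1)) (n ^ c)) : ℝ))
          =O[Filter.atTop] (fun n : ℕ => (n : ℝ) ^ β') →
      ∀ ε : ℝ, 0 < ε → ∃ γ γ' : ℝ, γ + γ' ≤ β + β' + ε ∧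
        (fun n : ℕ => (Literature.Computability.AlgebraicComplexity.tensorRank
          (Literature.Computability.AlgebraicComplexity.matMulTensor ℂ
            (n ^ (a + 1)) (n ^ (b + 1)) (n ^ c)) : ℝ))
            =O[Filter.atTop] (fun n : ℕ => (n : ℝ) ^ γ) ∧
        (fun n : ℕ => (Literature.Computability.AlgebraicComplexity.tensorRank
          (Literature.Computability.AlgebraicComplexity.matMulTensor ℂ (n ^ a) (n ^ b) (n ^ c)) : ℝ))
            =O[Filter.atTop] (fun n : ℕ => (n : ℝ) ^ γ') := by
  intro a b c ha hb hc β β' h₁ h₂ ε hε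
  by_cases hcore : dualExponentAlpha ℂ * ((max (min a b) (min (max a b) c) : ℕ) : ℝ) <
      ((min a (min b c) : ℕ) : ℝ)
  · by_cases hrs : (∀ δ : ℝ, 0 < δ → ∃ k p₁ p₂ p₃ p₄ p₅ p₆ p₇ p₈ : ℕ, ∃ f₁ g₁ h₁ f₂ g₂ h₂ : ℕ, ∃ u₁ u₂ : ℝ,
        1 ≤ k ∧ p₁ + p₂ + p₅ + p₆ ≤ k ∧ p₃ + p₄ + p₇ + p₈ ≤ k ∧
        k * a ≤ (p₁ + p₂) * (a + 1) + (p₃ + p₄) * a + f₁ ∧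
        k * b ≤ p₁ * b + p₂ * c + p₃ * (b + 1) + p₄ * c + g₁ ∧
        k * c ≤ p₁ * c + p₂ * b + p₃ * c + p₄ * (b + 1) + h₁ ∧
        k * (a + 1) ≤ (p₅ + p₆) * (a + 1) + (p₇ + p₈) * a + f₂ ∧
        k * (b + 1) ≤ p₅ * b + p₆ * c + p₇ * (b + 1) + p₈ * c + g₂ ∧
        k * c ≤ p₅ * c + p₆ * b + p₇ * c + p₈ * (b + 1) + h₂ ∧
        (fun n : ℕ => (Literature.Computability.AlgebraicComplexity.tensorRank
          (Literature.Computability.AlgebraicComplexity.matMulTensor ℂ (n ^ f₁) (n ^ g₁) (n ^ h₁)) : ℝ))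
            =O[Filter.atTop] (fun n : ℕ => (n : ℝ) ^ u₁) ∧
        (fun n : ℕ => (Literature.Computability.AlgebraicComplexity.tensorRank
          (Literature.Computability.AlgebraicComplexity.matMulTensor ℂ (n ^ f₂) (n ^ g₂) (n ^ h₂)) : ℝ))
            =O[Filter.atTop] (fun n : ℕ => (n : ℝ) ^ u₂) ∧
        u₁ + u₂ + (((p₁ + p₂ + p₅ + p₆) * (max (a + 1 + b) (max (b + c) (a + 1 + c))) + (p₃ + p₄ + p₇ + p₈) * (max (a + (b + 1)) (max (b + 1 + c) (a + c))) : ℕ) : ℝ)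
          ≤ ((k * (max (a + 1 + b) (max (b + c) (a + 1 + c)) + max (a + (b + 1)) (max (b + 1 + c) (a + c))) : ℕ) : ℝ) + δ)
    · exact Theorems.ShapeSubmodular.stub_cellOfRelSandwich a b c hrs β β' h₁ h₂ ε hε
    · exact stub_coreExchange a b c ha hb hc hcore hrs β β' h₁ h₂ ε hε
  · rw [not_lt] at hcore
    exact Theorems.ShapeSubmodular.stub_cellOfFlatMeet a b c (flatValue_of_alpha a b c ha hb hc hcore) β β'
      h₁ h₂ ε hε

/-- UNIT EXCHANGE in the coordinate pair (1,2) at fixed third coordinate, ALL cells, glued from the LANDED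
boundary theorem `Theorems.ShapeSubmodular.stub_unitExchangeBoundary` (cells `a = 0 ∨ b = 0 ∨ c = 0`) and the
interior law `unitExchangeInterior` (cells `a, b, c ≥ 1`) by case split (real proof). -/
theorem unitExchange :
    ∀ a b c : ℕ, ∀ β β' : ℝ,
      (fun n : ℕ => (Literature.Computability.AlgebraicComplexity.tensorRank
        (Literature.Computability.AlgebraicComplexity.matMulTensor ℂ (n ^ (a + 1)) (n ^ b) (n ^ c)) : ℝ))
          =O[Filter.atTop] (fun n : ℕ => (n : ℝ) ^ β) →
      (fun n : ℕ => (Literature.Computability.AlgebraicComplexity.tensorRank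
        (Literature.Computability.AlgebraicComplexity.matMulTensor ℂ (n ^ a) (n ^ (b + 1)) (n ^ c)) : ℝ))
          =O[Filter.atTop] (fun n : ℕ => (n : ℝ) ^ β') →
      ∀ ε : ℝ, 0 < ε → ∃ γ γ' : ℝ, γ + γ' ≤ β + β' + ε ∧
        (fun n : ℕ => (Literature.Computability.AlgebraicComplexity.tensorRank
          (Literature.Computability.AlgebraicComplexity.matMulTensor ℂ
            (n ^ (a + 1)) (n ^ (b + 1)) (n ^ c)) : ℝ))
            =O[Filter.atTop] (fun n : ℕ => (n : ℝ) ^ γ) ∧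
        (fun n : ℕ => (Literature.Computability.AlgebraicComplexity.tensorRank
          (Literature.Computability.AlgebraicComplexity.matMulTensor ℂ (n ^ a) (n ^ b) (n ^ c)) : ℝ))
            =O[Filter.atTop] (fun n : ℕ => (n : ℝ) ^ γ') := by
  intro a b c β β' h₁ h₂ ε hε
  rcases Nat.eq_zero_or_pos a with ha | ha
  · exact Theorems.ShapeSubmodular.stub_unitExchangeBoundary a b c (Or.inl ha) β β' h₁ h₂ ε hε
  rcases Nat.eq_zero_or_pos b with hb | hb
  · exact Theorems.ShapeSubmodular.stub_unitExchangeBoundary a b c (Or.inr (Or.inl hb)) β β' h₁ h₂ ε hε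
  rcases Nat.eq_zero_or_pos c with hc | hc
  · exact Theorems.ShapeSubmodular.stub_unitExchangeBoundary a b c (Or.inr (Or.inr hc)) β β' h₁ h₂ ε hε
  exact unitExchangeInterior a b c ha hb hc β β' h₁ h₂ ε hε

/-! ## Composition (real proofs from here on) -/

/-- The admissible exponents of the natural format `(a,b,c)`: `{β | R⟨n^a,n^b,n^c⟩ = O(n^β)}` (a `Set ℝ`,
the rectangular analogue of `admissibleExponents`; used only in the proofs below — the stubs above are stated
without it). -/
def adm (a b c : ℕ) : Set ℝ :=
  {β : ℝ | (fun n : ℕ => (tensorRank (matMulTensor ℂ (n ^ a) (n ^ b) (n ^ c)) : ℝ)) =O[atTop]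
    (fun n : ℕ => (n : ℝ) ^ β)}

/-- Cyclic symmetry of admissibility: `R⟨k,m,n⟩ = R⟨m,n,k⟩` (Bläser 2013, Lemma 5.5). -/
theorem adm_rotate (a b c : ℕ) (β : ℝ) : β ∈ adm a b c ↔ β ∈ adm b c a := by
  simp only [adm, Set.mem_setOf_eq]
  have h : (fun n : ℕ => (tensorRank (matMulTensor ℂ (n ^ a) (n ^ b) (n ^ c)) : ℝ)) =
      fun n : ℕ => (tensorRank (matMulTensor ℂ (n ^ b) (n ^ c) (n ^ a)) : ℝ) := by
    funext n
    rw [tensorRank_matMulTensor_rotate ℂ (n ^ a) (n ^ b) (n ^ c)]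
  rw [h]

/-- THE COMPOSITION with the three stub statements as hypotheses: exponent thresholds + Topkis'
local-to-global lemma + the unit exchange law in one coordinate pair ⟹ SUBMOD in rank form (the body of
`ShapeSubmodular`, verbatim up to the abbreviation `β ∈ adm a b c`). -/
theorem submod_of_parts
    (hT : ∀ a b c : ℕ, ∃ m : ℝ, (∀ β : ℝ, m < β → β ∈ adm a b c) ∧ (∀ β : ℝ, β ∈ adm a b c → m ≤ β))
    (hL : ∀ f : ℕ → ℕ → ℕ → ℝ,
      (∀ a b c : ℕ, f (a + 1) (b + 1) c + f a b c ≤ f (a + 1) b c + f a (b + 1) c) →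
      (∀ a b c : ℕ, f a (b + 1) (c + 1) + f a b c ≤ f a (b + 1) c + f a b (c + 1)) →
      (∀ a b c : ℕ, f (a + 1) b (c + 1) + f a b c ≤ f (a + 1) b c + f a b (c + 1)) →
      ∀ a b c a' b' c' : ℕ,
        f (max a a') (max b b') (max c c') + f (min a a') (min b b') (min c c') ≤
          f a b c + f a' b' c')
    (hU : ∀ a b c : ℕ, ∀ β β' : ℝ, β ∈ adm (a + 1) b c → β' ∈ adm a (b + 1) c →
      ∀ ε : ℝ, 0 < ε → ∃ γ γ' : ℝ, γ + γ' ≤ β + β' + ε ∧ γ ∈ adm (a + 1) (b + 1) c ∧ γ' ∈ adm a b c) :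
    ∀ a b c a' b' c' : ℕ, ∀ β β' : ℝ, β ∈ adm a b c → β' ∈ adm a' b' c' →
      ∀ ε : ℝ, 0 < ε → ∃ γ γ' : ℝ, γ + γ' ≤ β + β' + ε ∧
        γ ∈ adm (max a a') (max b b') (max c c') ∧ γ' ∈ adm (min a a') (min b b') (min c c') := by
  -- the threshold (exponent) function `m (a,b,c) = ω(a,b,c)` and its two defining properties
  choose m hm_adm hm_le using hT
  -- (1) the local exchange law for `m` in the pair (1,2), from the rank-form stub at slack `δ/4`
  have loc12 : ∀ a b c : ℕ, m (a + 1) (b + 1) c + m a b c ≤ m (a + 1) b c + m a (b + 1) c := by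
    intro a b c
    refine le_of_forall_pos_lt_add fun δ hδ => ?_
    obtain ⟨γ, γ', hsum, hγ, hγ'⟩ := hU a b c (m (a + 1) b c + δ / 4) (m a (b + 1) c + δ / 4)
      (hm_adm _ _ _ _ (by linarith)) (hm_adm _ _ _ _ (by linarith)) (δ / 4) (by positivity)
    have h₁ := hm_le _ _ _ _ hγ
    have h₂ := hm_le _ _ _ _ hγ'
    linarith
  -- (2) cyclic symmetry of `m`: both sides are the threshold of the same admissible set
  have mrot : ∀ a b c : ℕ, m a b c = m b c a := by
    intro a b c
    apply le_antisymm
    · refine le_of_forall_pos_lt_add fun δ hδ => ?_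
      have h : (m b c a + δ / 2) ∈ adm a b c :=
        (adm_rotate a b c _).2 (hm_adm b c a (m b c a + δ / 2) (by linarith))
      have := hm_le _ _ _ _ h
      linarith
    · refine le_of_forall_pos_lt_add fun δ hδ => ?_
      have h : (m a b c + δ / 2) ∈ adm b c a :=
        (adm_rotate a b c _).1 (hm_adm a b c (m a b c + δ / 2) (by linarith))
      have := hm_le _ _ _ _ h
      linarith
  -- (3) the local laws in the pairs (2,3) and (1,3), by rotating (1,2)
  have loc23 : ∀ a b c : ℕ, m a (b + 1) (c + 1) + m a b c ≤ m a (b + 1) c + m a b (c + 1) := by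
    intro a b c
    linarith [loc12 b c a, mrot a (b + 1) (c + 1), mrot a b c, mrot a (b + 1) c, mrot a b (c + 1)]
  have loc13 : ∀ a b c : ℕ, m (a + 1) b (c + 1) + m a b c ≤ m (a + 1) b c + m a b (c + 1) := by
    intro a b c
    linarith [loc12 c a b, mrot (c + 1) (a + 1) b, mrot c a b, mrot (c + 1) a b, mrot c (a + 1) b]
  -- (4) Topkis: `m` is submodular on the format lattice
  have sub := hL m loc12 loc23 loc13
  -- (5) back to rank form at slack `ε/2` on each of join and meet
  intro a b c a' b' c' β β' hβ hβ' ε hε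
  have h₁ : m a b c ≤ β := hm_le _ _ _ _ hβ
  have h₂ : m a' b' c' ≤ β' := hm_le _ _ _ _ hβ'
  refine ⟨m (max a a') (max b b') (max c c') + ε / 2, m (min a a') (min b b') (min c c') + ε / 2, ?_,
    hm_adm _ _ _ _ (by linarith), hm_adm _ _ _ _ (by linarith)⟩
  have h₃ := sub a b c a' b' c'
  linarith

/-- The crux BY NAME: `ShapeSubmodular` from the landed theorems `stub_exponentThreshold`,
`stub_localToGlobal`, `stub_unitExchangeBoundary`, `stub_flatValue`, `stub_cellOfFlatMeet` (all imported) and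
the one open stub `stub_coreExchange` (the skeleton theorem; `closed = false` only through that stub). -/
theorem ShapeSubmodular_of : ShapeSubmodular :=
  submod_of_parts Theorems.ShapeSubmodular.stub_exponentThreshold
    Theorems.ShapeSubmodular.stub_localToGlobal unitExchange

/-- CONVERSE (sorry-free): the open stub is an INSTANCE of the crux — `ShapeSubmodular` at the adjacent
pair `p = (a+1,b,c)`, `q = (a,b+1,c)` (join `(a+1,b+1,c)`, meet `(a,b,c)`) is exactly the interior unit
exchange law (indeed on every cell, the interior hypotheses are not even used).  Together with
`ShapeSubmodular_of` this makes the crux and `stub_unitExchangeInterior` kernel-equivalent after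
RESHAPE 2: the remaining stub is crux-strength by construction, not by accident. -/
theorem unitExchangeInterior_of_ShapeSubmodular (hS : ShapeSubmodular) :
    ∀ a b c : ℕ, 1 ≤ a → 1 ≤ b → 1 ≤ c → ∀ β β' : ℝ,
      (fun n : ℕ => (Literature.Computability.AlgebraicComplexity.tensorRank
        (Literature.Computability.AlgebraicComplexity.matMulTensor ℂ (n ^ (a + 1)) (n ^ b) (n ^ c)) : ℝ))
          =O[Filter.atTop] (fun n : ℕ => (n : ℝ) ^ β) →
      (fun n : ℕ => (Literature.Computability.AlgebraicComplexity.tensorRank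
        (Literature.Computability.AlgebraicComplexity.matMulTensor ℂ (n ^ a) (n ^ (b + 1)) (n ^ c)) : ℝ))
          =O[Filter.atTop] (fun n : ℕ => (n : ℝ) ^ β') →
      ∀ ε : ℝ, 0 < ε → ∃ γ γ' : ℝ, γ + γ' ≤ β + β' + ε ∧
        (fun n : ℕ => (Literature.Computability.AlgebraicComplexity.tensorRank
          (Literature.Computability.AlgebraicComplexity.matMulTensor ℂ
            (n ^ (a + 1)) (n ^ (b + 1)) (n ^ c)) : ℝ))
            =O[Filter.atTop] (fun n : ℕ => (n : ℝ) ^ γ) ∧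
        (fun n : ℕ => (Literature.Computability.AlgebraicComplexity.tensorRank
          (Literature.Computability.AlgebraicComplexity.matMulTensor ℂ (n ^ a) (n ^ b) (n ^ c)) : ℝ))
            =O[Filter.atTop] (fun n : ℕ => (n : ℝ) ^ γ') := by
  intro a b c _ha _hb _hc β β' h₁ h₂ ε hε
  obtain ⟨γ, γ', hsum, hjoin, hmeet⟩ := hS (a + 1) b c a (b + 1) c β β' h₁ h₂ ε hε
  rw [max_eq_left (Nat.le_succ a), max_eq_right (Nat.le_succ b), max_self] at hjoin
  rw [min_eq_right (Nat.le_succ a), min_eq_left (Nat.le_succ b), min_self] at hmeet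
  exact ⟨γ, γ', hsum, hjoin, hmeet⟩


/-- CONVERSE for the RESHAPE-7 open stub (sorry-free): `ShapeSubmodular` at the adjacent pair
`p = (a+1,b,c)`, `q = (a,b+1,c)` is the core exchange law (neither the core hypothesis nor the absence of a
certificate is even used), so after RESHAPE 7 the crux and `stub_coreExchange` are still KERNEL-EQUIVALENT —
the narrowing localises the difficulty, it cannot dissolve it. -/
theorem coreExchange_of_ShapeSubmodular (hS : ShapeSubmodular) :
    ∀ a b c : ℕ, 1 ≤ a → 1 ≤ b → 1 ≤ c →
      Literature.Computability.AlgebraicComplexity.dualExponentAlpha ℂ *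
          ((max (min a b) (min (max a b) c) : ℕ) : ℝ) < ((min a (min b c) : ℕ) : ℝ) →
      ¬ (∀ δ : ℝ, 0 < δ → ∃ k p₁ p₂ p₃ p₄ p₅ p₆ p₇ p₈ : ℕ, ∃ f₁ g₁ h₁ f₂ g₂ h₂ : ℕ, ∃ u₁ u₂ : ℝ,
        1 ≤ k ∧ p₁ + p₂ + p₅ + p₆ ≤ k ∧ p₃ + p₄ + p₇ + p₈ ≤ k ∧
        k * a ≤ (p₁ + p₂) * (a + 1) + (p₃ + p₄) * a + f₁ ∧
        k * b ≤ p₁ * b + p₂ * c + p₃ * (b + 1) + p₄ * c + g₁ ∧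
        k * c ≤ p₁ * c + p₂ * b + p₃ * c + p₄ * (b + 1) + h₁ ∧
        k * (a + 1) ≤ (p₅ + p₆) * (a + 1) + (p₇ + p₈) * a + f₂ ∧
        k * (b + 1) ≤ p₅ * b + p₆ * c + p₇ * (b + 1) + p₈ * c + g₂ ∧
        k * c ≤ p₅ * c + p₆ * b + p₇ * c + p₈ * (b + 1) + h₂ ∧
        (fun n : ℕ => (Literature.Computability.AlgebraicComplexity.tensorRank
          (Literature.Computability.AlgebraicComplexity.matMulTensor ℂ (n ^ f₁) (n ^ g₁) (n ^ h₁)) : ℝ))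
            =O[Filter.atTop] (fun n : ℕ => (n : ℝ) ^ u₁) ∧
        (fun n : ℕ => (Literature.Computability.AlgebraicComplexity.tensorRank
          (Literature.Computability.AlgebraicComplexity.matMulTensor ℂ (n ^ f₂) (n ^ g₂) (n ^ h₂)) : ℝ))
            =O[Filter.atTop] (fun n : ℕ => (n : ℝ) ^ u₂) ∧
        u₁ + u₂ + (((p₁ + p₂ + p₅ + p₆) * (max (a + 1 + b) (max (b + c) (a + 1 + c))) + (p₃ + p₄ + p₇ + p₈) * (max (a + (b + 1)) (max (b + 1 + c) (a + c))) : ℕ) : ℝ)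
          ≤ ((k * (max (a + 1 + b) (max (b + c) (a + 1 + c)) + max (a + (b + 1)) (max (b + 1 + c) (a + c))) : ℕ) : ℝ) + δ) →
      ∀ β β' : ℝ,
      (fun n : ℕ => (Literature.Computability.AlgebraicComplexity.tensorRank
        (Literature.Computability.AlgebraicComplexity.matMulTensor ℂ (n ^ (a + 1)) (n ^ b) (n ^ c)) : ℝ))
          =O[Filter.atTop] (fun n : ℕ => (n : ℝ) ^ β) →
      (fun n : ℕ => (Literature.Computability.AlgebraicComplexity.tensorRank
        (Literature.Computability.AlgebraicComplexity.matMulTensor ℂ (n ^ a) (n ^ (b + 1)) (n ^ c)) : ℝ))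
          =O[Filter.atTop] (fun n : ℕ => (n : ℝ) ^ β') →
      ∀ ε : ℝ, 0 < ε → ∃ γ γ' : ℝ, γ + γ' ≤ β + β' + ε ∧
        (fun n : ℕ => (Literature.Computability.AlgebraicComplexity.tensorRank
          (Literature.Computability.AlgebraicComplexity.matMulTensor ℂ
            (n ^ (a + 1)) (n ^ (b + 1)) (n ^ c)) : ℝ))
            =O[Filter.atTop] (fun n : ℕ => (n : ℝ) ^ γ) ∧
        (fun n : ℕ => (Literature.Computability.AlgebraicComplexity.tensorRank
          (Literature.Computability.AlgebraicComplexity.matMulTensor ℂ (n ^ a) (n ^ b) (n ^ c)) : ℝ))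
            =O[Filter.atTop] (fun n : ℕ => (n : ℝ) ^ γ') := by
  intro a b c ha hb hc _hcore _hrs β β' h₁ h₂ ε hε
  exact unitExchangeInterior_of_ShapeSubmodular hS a b c ha hb hc β β' h₁ h₂ ε hε

/-- GLUE (real proof): a sandwichable cell (`stub_cellOfSandwich`, RESHAPE 5) carries a relative-sandwich
certificate — `k = 1`, no `P`/`Q`-weights, `F₁ = M`, `F₂ = J`. -/
theorem relSandwich_of_sandwich (a b c : ℕ)
    (hsw : (∃ u u' : ℝ,
        u + u' ≤ ((max (a + 1 + b) (max (b + c) (a + 1 + c)) + max (a + (b + 1)) (max (b + 1 + c) (a + c)) : ℕ) : ℝ) ∧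
        (fun n : ℕ => (Literature.Computability.AlgebraicComplexity.tensorRank
          (Literature.Computability.AlgebraicComplexity.matMulTensor ℂ
            (n ^ (a + 1)) (n ^ (b + 1)) (n ^ c)) : ℝ))
            =O[Filter.atTop] (fun n : ℕ => (n : ℝ) ^ u) ∧
        (fun n : ℕ => (Literature.Computability.AlgebraicComplexity.tensorRank
          (Literature.Computability.AlgebraicComplexity.matMulTensor ℂ (n ^ a) (n ^ b) (n ^ c)) : ℝ))
            =O[Filter.atTop] (fun n : ℕ => (n : ℝ) ^ u'))) :
    (∀ δ : ℝ, 0 < δ → ∃ k p₁ p₂ p₃ p₄ p₅ p₆ p₇ p₈ : ℕ, ∃ f₁ g₁ h₁ f₂ g₂ h₂ : ℕ, ∃ u₁ u₂ : ℝ,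
        1 ≤ k ∧ p₁ + p₂ + p₅ + p₆ ≤ k ∧ p₃ + p₄ + p₇ + p₈ ≤ k ∧
        k * a ≤ (p₁ + p₂) * (a + 1) + (p₃ + p₄) * a + f₁ ∧
        k * b ≤ p₁ * b + p₂ * c + p₃ * (b + 1) + p₄ * c + g₁ ∧
        k * c ≤ p₁ * c + p₂ * b + p₃ * c + p₄ * (b + 1) + h₁ ∧
        k * (a + 1) ≤ (p₅ + p₆) * (a + 1) + (p₇ + p₈) * a + f₂ ∧
        k * (b + 1) ≤ p₅ * b + p₆ * c + p₇ * (b + 1) + p₈ * c + g₂ ∧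
        k * c ≤ p₅ * c + p₆ * b + p₇ * c + p₈ * (b + 1) + h₂ ∧
        (fun n : ℕ => (Literature.Computability.AlgebraicComplexity.tensorRank
          (Literature.Computability.AlgebraicComplexity.matMulTensor ℂ (n ^ f₁) (n ^ g₁) (n ^ h₁)) : ℝ))
            =O[Filter.atTop] (fun n : ℕ => (n : ℝ) ^ u₁) ∧
        (fun n : ℕ => (Literature.Computability.AlgebraicComplexity.tensorRank
          (Literature.Computability.AlgebraicComplexity.matMulTensor ℂ (n ^ f₂) (n ^ g₂) (n ^ h₂)) : ℝ))
            =O[Filter.atTop] (fun n : ℕ => (n : ℝ) ^ u₂) ∧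
        u₁ + u₂ + (((p₁ + p₂ + p₅ + p₆) * (max (a + 1 + b) (max (b + c) (a + 1 + c))) + (p₃ + p₄ + p₇ + p₈) * (max (a + (b + 1)) (max (b + 1 + c) (a + c))) : ℕ) : ℝ)
          ≤ ((k * (max (a + 1 + b) (max (b + c) (a + 1 + c)) + max (a + (b + 1)) (max (b + 1 + c) (a + c))) : ℕ) : ℝ) + δ) := by
  obtain ⟨u, u', hsum, hu, hu'⟩ := hsw
  intro δ hδ
  refine ⟨1, 0, 0, 0, 0, 0, 0, 0, 0, a, b, c, a + 1, b + 1, c, u', u, le_rfl, by omega, by omega,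
    by omega, by omega, by omega, by omega, by omega, by omega, hu', hu, ?_⟩
  push_cast at hsum ⊢
  nlinarith [hsum, hδ]

/-- COROLLARY (sorry-free: the landed `stub_cellOfSandwich` p153815 and `stub_sandwichRay11` p154066): under the ADVXXZ2025
table fact, the exchange law holds on the whole ray of core cells with meet `(1,1,c)`, `c ≥ 2` — the side
stubs compose with the glue (`1 + 1 = 2` and `n ^ 1` bookkeeping only). -/
theorem cell_one_one_of_table
    (hT : Literature.Computability.AlgebraicComplexity.advxxz2025_omegaRect_table) (c : ℕ) (hc : 2 ≤ c) :
    ∀ β β' : ℝ,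
      (fun n : ℕ => (Literature.Computability.AlgebraicComplexity.tensorRank
        (Literature.Computability.AlgebraicComplexity.matMulTensor ℂ (n ^ (1 + 1)) (n ^ 1) (n ^ c)) : ℝ))
          =O[Filter.atTop] (fun n : ℕ => (n : ℝ) ^ β) →
      (fun n : ℕ => (Literature.Computability.AlgebraicComplexity.tensorRank
        (Literature.Computability.AlgebraicComplexity.matMulTensor ℂ (n ^ 1) (n ^ (1 + 1)) (n ^ c)) : ℝ))
          =O[Filter.atTop] (fun n : ℕ => (n : ℝ) ^ β') →
      ∀ ε : ℝ, 0 < ε → ∃ γ γ' : ℝ, γ + γ' ≤ β + β' + ε ∧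
        (fun n : ℕ => (Literature.Computability.AlgebraicComplexity.tensorRank
          (Literature.Computability.AlgebraicComplexity.matMulTensor ℂ
            (n ^ (1 + 1)) (n ^ (1 + 1)) (n ^ c)) : ℝ))
            =O[Filter.atTop] (fun n : ℕ => (n : ℝ) ^ γ) ∧
        (fun n : ℕ => (Literature.Computability.AlgebraicComplexity.tensorRank
          (Literature.Computability.AlgebraicComplexity.matMulTensor ℂ (n ^ 1) (n ^ 1) (n ^ c)) : ℝ))
            =O[Filter.atTop] (fun n : ℕ => (n : ℝ) ^ γ') := by
  refine Theorems.ShapeSubmodular.stub_cellOfSandwich 1 1 c ?_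
  obtain ⟨u, u', hsum, hu, hu'⟩ := Theorems.ShapeSubmodular.stub_sandwichRay11 hT c hc
  refine ⟨u, u', ?_, ?_, hu'⟩
  · have hL : ((max (1 + 1 + 1) (max (1 + c) (1 + 1 + c)) + max (1 + (1 + 1)) (max (1 + 1 + c) (1 + c)) : ℕ) : ℝ)
        = 2 * ((c : ℝ) + 2) := by
      have h : (max (1 + 1 + 1) (max (1 + c) (1 + 1 + c)) + max (1 + (1 + 1)) (max (1 + 1 + c) (1 + c)) : ℕ)
          = 2 * (c + 2) := by omega
      rw [h]; push_cast; ring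
    rw [hL]; exact hsum
  · simpa using hu

end Summit.MatrixMultiplication.MatrixMultiplication.Cruxes.ShapeSubmodular.Birth
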